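import Literature.AlgebraicGeometry.HodgeTheory.ProjectiveIdealSheafRegularityCriterion
import Literature.AlgebraicGeometry.HodgeTheory.ProjectiveIdealSheafH1Normality
import Literature.AlgebraicGeometry.HodgeTheory.ProjectiveCohomologicalHilbertFunctions
import HarnessLib

/-!
# Regularity of a zero-dimensional scheme = independence of the conditions it imposes (Eisenbud, GoS Cor. 4.7)

Eisenbud, *The Geometry of Syzygies*, §4 (Cor. 4.7 and the discussion on PDF p. 99): for a finite
(zero-dimensional) `X ⊆ ℙ^r`, the regularity of `S_X` is the smallest `d` such that `X` imposes
independent conditions on forms of degree `d`; equivalently `𝓘_X` is `m`-regular iff `X` imposes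
independent conditions on forms of degree `m - 1`, i.e. iff `S_{m-1} → Γ(𝒪_X(m-1))` is onto, iff
`H¹(𝓘_X(m-1)) = 0` (Mumford, Lecture 14: `𝒪_X` of a zero-dimensional `X` is `n`-regular for all `n`).

In the tree's Čech language, for `I ⊆ S` graded with CONSTANT Hilbert polynomial (`J = Unit`, `e = 0`;
`k` an infinite field):

* (`ProjectiveCohomologicalHilbertFunctions.regular_of_natDegree_eq_zero`: `(F_e ⧸ K)~` with constant
  `χ`-polynomial is `n`-regular for every `n`;)
* **`LaurentCech.regular_cech_iff_isZero_homology_one_of_natDegree_eq_zero`** — `K~` is `m`-regular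
  iff `H¹(Č_{m-1}(K)) = 0` (`e_j ≤ m - 1`);
* **`LaurentCech.regular_cech_iff_surjective_alphaH0`** — iff `α_{m-1} : (F_e)_{m-1} → H⁰(Č_{m-1}(F_e ⧸ K))`
  is onto (`r ≥ 2`): "`Z` imposes independent conditions on forms of degree `m - 1`";
* **`LaurentCech.regular_cech_iff_choose_eq`** — for `Z = V(I) ⊆ ℙ^r` of length `N`, `m ≥ 1`, `r ≥ 2`:
  `𝓘_Z` is `m`-regular iff `C(m - 1 + r, r) = N + dim Ī_{m-1}` (the `N` conditions are independent).

## References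

* [Eisenbud2005] D. Eisenbud, *The Geometry of Syzygies*, GTM 229, Springer 2005, Cor. 4.7, §4C
  (PDF p. 99), Thm. 4.1.
* [Mumford1966CurvesSurface] D. Mumford, *Lectures on Curves on an Algebraic Surface*, Lecture 14
  (pp. 99–102).
-/

noncomputable section

open CategoryTheory CategoryTheory.Limits Polynomial

universe u

namespace Literature.Algebra.Homology

namespace LaurentCech

open OrderedCech TopCohomology

variable {k : Type u} [Field k] [Infinite k] {r : ℕ} {J : Type} [Fintype J] (e : J → ℤ)

/-- **`K~` with constant `χ`-polynomial of `F_e ⧸ K` (zero-dimensional support) is `m`-regular iff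
`H¹(Č_{m-1}(K)) = 0`** (`e_j ≤ m - 1`; for ideal sheaves `m ≥ 1`): `(F_e ⧸ K)~` is `n`-regular for
every `n` (`regular_of_natDegree_eq_zero`), so the criterion `regular_cech_iff` reduces to its
`H¹`-clause. [cite: Eisenbud2005, Cor. 4.7 (PDF p. 99)] [cite: Mumford1966CurvesSurface, Lecture 14 (p. 99)] -/
theorem regular_cech_iff_isZero_homology_one_of_natDegree_eq_zero (hr : 1 ≤ r)
    {K : Submodule (P k r) (J → P k r)} (hK : IsGraded e K) {Q : ℚ[X]}
    (hQ : ∀ n : ℤ, ((∑ q ∈ Finset.range (r + 1), (-1 : ℤ) ^ q *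
      (Module.finrank k ((quot e K n).homology q) : ℤ) : ℤ) : ℚ) = Q.eval (n : ℚ))
    (hQ0 : Q.natDegree = 0) (m : ℤ) (he : ∀ j, e j ≤ m - 1) :
    (∀ i : ℤ, 1 ≤ i → IsZero ((cech e K (m - i)).homology i)) ↔
      IsZero ((cech e K (m - 1)).homology 1) := by
  rw [regular_cech_iff e hr m he]
  exact ⟨fun h => h.2, fun h => ⟨regular_of_natDegree_eq_zero e hr hK hQ hQ0 (m - 1), h⟩⟩

/-- **… iff `α_{m-1} : (F_e)_{m-1} → H⁰(Č_{m-1}(F_e ⧸ K))` is onto** (`r ≥ 2`): the zero-dimensional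
scheme "imposes independent conditions on forms of degree `m - 1`".
[cite: Eisenbud2005, Cor. 4.7 (PDF p. 99)] [cite: Mumford1966CurvesSurface, Lecture 14 (pp. 99–102)] -/
theorem regular_cech_iff_surjective_alphaH0 (hr : 2 ≤ r) {K : Submodule (P k r) (J → P k r)}
    (hK : IsGraded e K) {Q : ℚ[X]}
    (hQ : ∀ n : ℤ, ((∑ q ∈ Finset.range (r + 1), (-1 : ℤ) ^ q *
      (Module.finrank k ((quot e K n).homology q) : ℤ) : ℤ) : ℚ) = Q.eval (n : ℚ))
    (hQ0 : Q.natDegree = 0) (m : ℤ) (he : ∀ j, e j ≤ m - 1) :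
    (∀ i : ℤ, 1 ≤ i → IsZero ((cech e K (m - i)).homology i)) ↔
      Function.Surjective (alphaH0 e K (one_le_two.trans hr) (m - 1)) := by
  rw [regular_cech_iff_isZero_homology_one_of_natDegree_eq_zero e (one_le_two.trans hr) hK hQ hQ0 m he,
    surjective_alphaH0_iff_isZero_homology_one e K (m - 1) hr]

/-- **Zero-dimensional `Z = V(I) ⊆ ℙ^r_k` of length `N`: `𝓘_Z` is `m`-regular iff
`C(m - 1 + r, r) = N + dim Ī_{m-1}`** (`m ≥ 1`, `r ≥ 2`), i.e. iff the `N` linear conditions that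
`Z` imposes on forms of degree `m - 1` are independent (`h¹(𝓘_Z(m-1)) + C(m-1+r, r) = N + dim Ī_{m-1}`).
[cite: Eisenbud2005, Cor. 4.7 (PDF p. 99)] [cite: Mumford1966CurvesSurface, Lecture 14 (pp. 99–102)] -/
theorem regular_cech_iff_choose_eq (hr : 2 ≤ r) {I : Submodule (P k r) (Unit → P k r)}
    (hI : IsGraded (fun _ : Unit => (0 : ℤ)) I) {N : ℕ}
    (hQ : ∀ n : ℤ, ((∑ q ∈ Finset.range (r + 1), (-1 : ℤ) ^ q *
      (Module.finrank k ((quot (fun _ : Unit => (0 : ℤ)) I n).homology q) : ℤ) : ℤ) : ℚ) =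
        (C (N : ℚ)).eval (n : ℚ))
    {m : ℤ} (hm : 1 ≤ m) :
    (∀ i : ℤ, 1 ≤ i → IsZero ((cech (fun _ : Unit => (0 : ℤ)) I (m - i)).homology i)) ↔
      ((m - 1).toNat + r).choose r =
        N + Module.finrank k (degPiece (fun _ : Unit => (0 : ℤ)) (sat I) (m - 1)) := by
  have hr1 : 1 ≤ r := one_le_two.trans hr
  rw [regular_cech_iff_isZero_homology_one_of_natDegree_eq_zero (fun _ : Unit => (0 : ℤ)) hr1 hI hQ
    (natDegree_C _) m (fun _ => by omega)]
  -- the defect formula `h¹ + C(m-1+r, r) = h⁰ + dim Ī_{m-1}` with `h⁰ = N`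
  have hdef := finrank_homology_cech_one_add_choose hr hI (d := m - 1) (by omega)
  have h0 : Module.finrank k ((quot (fun _ : Unit => (0 : ℤ)) I (m - 1)).homology 0) = N := by
    have h := finrank_homology_quot_zero_eq_eval_of_natDegree_eq_zero (fun _ : Unit => (0 : ℤ)) hr1 hI
      hQ (natDegree_C _) (m - 1)
    rw [eval_C] at h
    exact_mod_cast h
  rw [h0] at hdef
  haveI : Module.Finite k ((cech (fun _ : Unit => (0 : ℤ)) I (m - 1)).homology 1) :=
    moduleFinite_homology_cech (fun _ : Unit => (0 : ℤ)) hI (m - 1) 1 le_rfl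
  rw [ModuleCat.isZero_iff_subsingleton, ← Module.finrank_zero_iff (R := k)]
  omega

end LaurentCech

end Literature.Algebra.Homology

end
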